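import Mathlib
import Summits.AtomisticToContinuum.Crystallization.Theorems.SquareWellLayerCakeStackingFaultSparsityExactLatticeLedgerSiteTails

/-!
# Exact-lattice ledger, VII: the remainder at a disc site; disc counts (helper file)

Crux `StackingFaultSparsity` (item stmt-AtomisticToContinuum-14296, routes `SquareWellLayerCake` /
`LaminarSixThreeThree`), line `Sketch`, stub `stub_exactLatticeLedger` (survey obligation M3c+e, the
exact-lattice ledger of the cylinder block flip; landing file
`SquareWellLayerCakeStackingFaultSparsityExactLatticeLedger.lean`, whose module docstring has the
overall map).

`ledger_up_site_error` (carrier; assembly of `ledger_up_site_rim` and `ledger_up_site_tails`: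
per layer the remainder is (rim) - (new tail) + (old tail), the layer families being summable),
`ledger_base_count_ge` (`#base disc ≥ ρ²/4`), `ledger_disc_count_sub_le` (`|n_m - ncol| ≤ 143 ρ`),
`abs_localEnergyTrunc_flip_sub_le` (`|ΔF_K(m)| ≤ J₀` on the box).
-/

noncomputable section
namespace Summit.AtomisticToContinuum.Crystallization.Theorems.SquareWellLayerCake.StackingFaultSparsity
open Literature.MathematicalPhysics.StatisticalMechanics

/-! ## 5d. The remainder at a disc site; disc counts; the chain change on the box -/

/-- **The remainder at a disc site (L4 + L5).** There is `A ≥ 0` such that for a lower site `q`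
in the lateral disc of layer `m ∈ [q₁ - K, q₂]`, at depth `t = ρ - √latSq(q)`, the remainder of
`ledger_up_site_identity` is `≤ A max(t - 2, 1/2)⁻³` in absolute value.  Per layer `m + k` it is
(i) RIM: the window points of a moved layer OUTSIDE the disc are not displaced while the full-layer
comparison displaces them — they are at lateral distance `> t` from `q` (`≥ t - 6/5` after the
shifts); (ii) TRUNCATION: the full layer minus the window consists of points beyond `R` from the
base, at distance `≥ R - |q - b| ≥ 1 + t` from `q` (`≥ t - 1/5` after the shifts); both partner
families are `1/2`-separated subsets of refined lattices, `|V| ≤ 6 r⁻⁶`, and the tails are bounded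
by the two-scale shell sum (finite part) and its `tsum` version (the layer sums are summable:
`summable_ljMajorant_norm_layerVec`, or `LayerSumDecay`). [folklore] -/
theorem ledger_up_site_error : ∃ A : ℝ, 0 ≤ A ∧ ∀ K : ℕ, 2 ≤ K →
    ∀ (a h : ℝ) (s : ℤ → ℤ) (q₁ q₂ i₀ j₀ : ℤ) (ρ R : ℝ) (I : Finset (ℤ × ℤ × ℤ))
      (D : ℤ × ℤ × ℤ → (EuclideanSpace ℝ (Fin 3))) (Δ : ℤ × ℤ × ℤ → ℤ × ℤ × ℤ → ℝ),
      InBox a h → IsHaggSeq s → q₁ < q₂ → (3 : ℤ) ∣ haggLabel s q₂ - haggLabel s q₁ → 1 ≤ ρ →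
      ρ + ((q₂ : ℝ) - q₁) * h + K * h + 1 ≤ R →
      (∀ q, InCyl a h s q₁ q₂ i₀ j₀ ρ q.1 q.2.1 q.2.2 →
        D q = ((shiftSign s q₁ q.1 : ℤ) : ℝ) • barlowOffset a) →
      (∀ q, ¬ InCyl a h s q₁ q₂ i₀ j₀ ρ q.1 q.2.1 q.2.2 → D q = 0) →
      (∀ q q', Δ q q' =
        lennardJones (dist (barlowPos a h s q.1 q.2.1 q.2.2 + D q)
            (barlowPos a h s q'.1 q'.2.1 q'.2.2 + D q')) -
          lennardJones (dist (barlowPos a h s q.1 q.2.1 q.2.2)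
            (barlowPos a h s q'.1 q'.2.1 q'.2.2))) →
      (∀ q, q ∈ I ↔ dist (barlowPos a h s q.1 q.2.1 q.2.2) (barlowPos a h s q₁ i₀ j₀) ≤ R) →
      ∀ m ∈ Finset.Icc (q₁ - K) q₂, ∀ q ∈ I, q.1 = m → (latSq (barlowPos a h s q.1 q.2.1 q.2.2) (barlowPos a h s q₁ i₀ j₀) ≤ ρ ^ 2) →
        |∑ k ∈ Finset.Icc 1 K,
            ((∑ q' ∈ I.filter (fun q' => q'.1 = m + k),
            lennardJones (dist (barlowPos a h s q.1 q.2.1 q.2.2 + D q)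
              (barlowPos a h s q'.1 q'.2.1 q'.2.2 + D q')) -
          ∑' ij : ℤ × ℤ, lennardJones (dist (barlowPos a h s q.1 q.2.1 q.2.2 + D q)
              (barlowPos a h s (m + k) ij.1 ij.2 +
                (((fun n : ℤ => if q₁ < n ∧ n < q₂ then shiftSign s q₁ n else 0) (m + k) : ℤ) : ℝ) •
                  barlowOffset a))) -
         (∑ q' ∈ I.filter (fun q' => q'.1 = m + k),
            lennardJones (dist (barlowPos a h s q.1 q.2.1 q.2.2) (barlowPos a h s q'.1 q'.2.1 q'.2.2)) -
          ∑' ij : ℤ × ℤ, lennardJones (dist (barlowPos a h s q.1 q.2.1 q.2.2)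
              (barlowPos a h s (m + k) ij.1 ij.2))))| ≤
          A * (max (ρ - √(latSq (barlowPos a h s q.1 q.2.1 q.2.2) (barlowPos a h s q₁ i₀ j₀)) - 2)
            (1 / 2))⁻¹ ^ 3 := by
  refine ⟨44000, by norm_num, ?_⟩
  intro K hK a h s q₁ q₂ i₀ j₀ ρ R I D Δ hbox hs hq hcharge hρ hR hD₁ hD₀ hΔ hI m hm q hqI hqm hdisc
  classical
  subst hqm
  obtain ⟨ha, hh⟩ := InBox.pos hbox
  have hJ1 := ledger_up_site_rim K hK a h s q₁ q₂ i₀ j₀ ρ R I D Δ hbox hs hq hcharge hρ hR hD₁ hD₀ hΔ hI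
    q hqI hm hdisc
  obtain ⟨htailN, htailO⟩ := ledger_up_site_tails K hK a h s q₁ q₂ i₀ j₀ ρ R I D Δ hbox hs hq hcharge hρ hR
    hD₁ hD₀ hΔ hI q hqI hm hdisc
  set M : ℝ := (max (ρ - √(latSq (barlowPos a h s q.1 q.2.1 q.2.2) (barlowPos a h s q₁ i₀ j₀)) - 2) (1 / 2)) with hM
  have hDq : D q = (((fun n : ℤ => if q₁ < n ∧ n < q₂ then shiftSign s q₁ n else 0) q.1 : ℤ) : ℝ) • barlowOffset a := by
    by_cases hmid : q₁ < q.1 ∧ q.1 < q₂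
    · rw [hD₁ q ⟨hmid.1, hmid.2, hdisc⟩]
      simp only [hmid, and_self, if_true]
    · rw [hD₀ q (fun hc => hmid ⟨hc.1, hc.2.1⟩)]
      simp only [hmid, if_false, Int.cast_zero, zero_smul]
  -- reindexing of the finite window sums by in-layer indices
  have hF : ∀ (k : ℕ) (g : ℤ × ℤ × ℤ → ℝ), ∑ q' ∈ I.filter (fun q' => q'.1 = q.1 + k), g q' =
      ∑ ij ∈ (I.filter (fun q' => q'.1 = q.1 + k)).image (fun q' => q'.2), g (q.1 + k, ij) := by
    intro k g
    rw [Finset.sum_image]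
    · refine Finset.sum_congr rfl fun q' hq' => ?_
      rw [Finset.mem_filter] at hq'
      rw [← hq'.2, Prod.mk.eta]
    · intro q' hq' q'' hq'' hqq
      rw [Finset.coe_filter, Set.mem_setOf_eq] at hq' hq''
      exact Prod.ext (hq'.2.trans hq''.2.symm) hqq
  -- summability of the layer families
  have hsumO : ∀ k : ℕ, 1 ≤ k → Summable (fun ij : ℤ × ℤ =>
      lennardJones (dist (barlowPos a h s q.1 q.2.1 q.2.2) (barlowPos a h s (q.1 + k) ij.1 ij.2))) := by
    intro k hk
    have := summable_lennardJones_shift_layer ha hh s q.1 q.2.1 q.2.2 (q.1 + k) 0 0 (by omega)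
    simpa using this
  have hsumN : ∀ k : ℕ, 1 ≤ k → Summable (fun ij : ℤ × ℤ =>
      lennardJones (dist (barlowPos a h s q.1 q.2.1 q.2.2 + D q)
        (barlowPos a h s (q.1 + k) ij.1 ij.2 + (((fun n : ℤ => if q₁ < n ∧ n < q₂ then shiftSign s q₁ n else 0) (q.1 + k) : ℤ) : ℝ) • barlowOffset a))) := by
    intro k hk
    rw [hDq]
    exact summable_lennardJones_shift_layer ha hh s q.1 q.2.1 q.2.2 (q.1 + k) _ _ (by omega)
  have hkey : ∀ k ∈ Finset.Icc 1 K,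
      |((∑ q' ∈ I.filter (fun q' => q'.1 = q.1 + k),
            lennardJones (dist (barlowPos a h s q.1 q.2.1 q.2.2 + D q)
              (barlowPos a h s q'.1 q'.2.1 q'.2.2 + D q')) -
          ∑' ij : ℤ × ℤ, lennardJones (dist (barlowPos a h s q.1 q.2.1 q.2.2 + D q)
              (barlowPos a h s (q.1 + k) ij.1 ij.2 +
                (((fun n : ℤ => if q₁ < n ∧ n < q₂ then shiftSign s q₁ n else 0) (q.1 + k) : ℤ) : ℝ) •
                  barlowOffset a))) -
         (∑ q' ∈ I.filter (fun q' => q'.1 = q.1 + k),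
            lennardJones (dist (barlowPos a h s q.1 q.2.1 q.2.2) (barlowPos a h s q'.1 q'.2.1 q'.2.2)) -
          ∑' ij : ℤ × ℤ, lennardJones (dist (barlowPos a h s q.1 q.2.1 q.2.2)
              (barlowPos a h s (q.1 + k) ij.1 ij.2))))| ≤
      ∑ ij ∈ (I.filter (fun q' => q'.1 = q.1 + k)).image (fun q' => q'.2),
        |lennardJones (dist (barlowPos a h s q.1 q.2.1 q.2.2 + D q)
            (barlowPos a h s (q.1 + k) ij.1 ij.2 + D (q.1 + k, ij))) -
          lennardJones (dist (barlowPos a h s q.1 q.2.1 q.2.2 + D q)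
            (barlowPos a h s (q.1 + k) ij.1 ij.2 + (((fun n : ℤ => if q₁ < n ∧ n < q₂ then shiftSign s q₁ n else 0) (q.1 + k) : ℤ) : ℝ) • barlowOffset a))| +
      ∑' ij : ↥((↑((I.filter (fun q' => q'.1 = q.1 + k)).image (fun q' => q'.2)) : Set (ℤ × ℤ))ᶜ),
        |lennardJones (dist (barlowPos a h s q.1 q.2.1 q.2.2 + D q)
          (barlowPos a h s (q.1 + k) ij.1.1 ij.1.2 + (((fun n : ℤ => if q₁ < n ∧ n < q₂ then shiftSign s q₁ n else 0) (q.1 + k) : ℤ) : ℝ) • barlowOffset a))| +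
      ∑' ij : ↥((↑((I.filter (fun q' => q'.1 = q.1 + k)).image (fun q' => q'.2)) : Set (ℤ × ℤ))ᶜ),
        |lennardJones (dist (barlowPos a h s q.1 q.2.1 q.2.2) (barlowPos a h s (q.1 + k) ij.1.1 ij.1.2))| := by
    intro k hk
    rw [Finset.mem_Icc] at hk
    have hSN := (hsumN k hk.1).sum_add_tsum_compl
      (s := (I.filter (fun q' => q'.1 = q.1 + k)).image (fun q' => q'.2))
    have hSO := (hsumO k hk.1).sum_add_tsum_compl
      (s := (I.filter (fun q' => q'.1 = q.1 + k)).image (fun q' => q'.2))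
    rw [hF k (fun q' => lennardJones (dist (barlowPos a h s q.1 q.2.1 q.2.2 + D q)
      (barlowPos a h s q'.1 q'.2.1 q'.2.2 + D q'))),
      hF k (fun q' => lennardJones (dist (barlowPos a h s q.1 q.2.1 q.2.2) (barlowPos a h s q'.1 q'.2.1 q'.2.2)))]
    dsimp only
    rw [← hSN, ← hSO]
    beta_reduce
    have hT1 : |∑' ij : ↥((↑((I.filter (fun q' => q'.1 = q.1 + k)).image (fun q' => q'.2)) : Set (ℤ × ℤ))ᶜ),
        lennardJones (dist (barlowPos a h s q.1 q.2.1 q.2.2 + D q)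
          (barlowPos a h s (q.1 + k) ij.1.1 ij.1.2 +
            ((if q₁ < q.1 + k ∧ q.1 + k < q₂ then shiftSign s q₁ (q.1 + k) else 0 : ℤ) : ℝ) • barlowOffset a))| ≤
        ∑' ij : ↥((↑((I.filter (fun q' => q'.1 = q.1 + k)).image (fun q' => q'.2)) : Set (ℤ × ℤ))ᶜ),
        |lennardJones (dist (barlowPos a h s q.1 q.2.1 q.2.2 + D q)
          (barlowPos a h s (q.1 + k) ij.1.1 ij.1.2 +
            ((if q₁ < q.1 + k ∧ q.1 + k < q₂ then shiftSign s q₁ (q.1 + k) else 0 : ℤ) : ℝ) • barlowOffset a))| := by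
      have hsub := (hsumN k hk.1).comp_injective
        (i := (Subtype.val : ↥((↑((I.filter (fun q' => q'.1 = q.1 + k)).image (fun q' => q'.2)) : Set (ℤ × ℤ))ᶜ) → ℤ × ℤ))
        Subtype.val_injective
      simpa only [Real.norm_eq_abs, Function.comp_apply] using norm_tsum_le_tsum_norm hsub.norm
    have hT2 : |∑' ij : ↥((↑((I.filter (fun q' => q'.1 = q.1 + k)).image (fun q' => q'.2)) : Set (ℤ × ℤ))ᶜ),
        lennardJones (dist (barlowPos a h s q.1 q.2.1 q.2.2) (barlowPos a h s (q.1 + k) ij.1.1 ij.1.2))| ≤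
        ∑' ij : ↥((↑((I.filter (fun q' => q'.1 = q.1 + k)).image (fun q' => q'.2)) : Set (ℤ × ℤ))ᶜ),
        |lennardJones (dist (barlowPos a h s q.1 q.2.1 q.2.2) (barlowPos a h s (q.1 + k) ij.1.1 ij.1.2))| := by
      have hsub := (hsumO k hk.1).comp_injective
        (i := (Subtype.val : ↥((↑((I.filter (fun q' => q'.1 = q.1 + k)).image (fun q' => q'.2)) : Set (ℤ × ℤ))ᶜ) → ℤ × ℤ))
        Subtype.val_injective
      simpa only [Real.norm_eq_abs, Function.comp_apply] using norm_tsum_le_tsum_norm hsub.norm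
    have hfin : |∑ ij ∈ (I.filter (fun q' => q'.1 = q.1 + k)).image (fun q' => q'.2),
        (lennardJones (dist (barlowPos a h s q.1 q.2.1 q.2.2 + D q)
            (barlowPos a h s (q.1 + k) ij.1 ij.2 + D (q.1 + k, ij))) -
          lennardJones (dist (barlowPos a h s q.1 q.2.1 q.2.2 + D q)
            (barlowPos a h s (q.1 + k) ij.1 ij.2 + (((fun n : ℤ => if q₁ < n ∧ n < q₂ then shiftSign s q₁ n else 0) (q.1 + k) : ℤ) : ℝ) • barlowOffset a)))| ≤ _ :=
      Finset.abs_sum_le_sum_abs _ _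
    rw [Finset.sum_sub_distrib] at hfin
    beta_reduce at hfin
    -- the expression inside the absolute value, regrouped
    have e : ∀ (A B TN C TO : ℝ), A - (B + TN) - (C - (C + TO)) = (A - B) - TN + TO := fun _ _ _ _ _ => by ring
    rw [e]
    have hineq : ∀ (X TN TO : ℝ), |X - TN + TO| ≤ |X| + |TN| + |TO| := fun X TN TO =>
      (abs_add_le _ _).trans (add_le_add (abs_sub _ _) le_rfl)
    refine (hineq _ _ _).trans ?_
    linarith [hfin, hT1, hT2]
  -- sum over the layers
  calc |∑ k ∈ Finset.Icc 1 K, ((∑ q' ∈ I.filter (fun q' => q'.1 = q.1 + k),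
            lennardJones (dist (barlowPos a h s q.1 q.2.1 q.2.2 + D q)
              (barlowPos a h s q'.1 q'.2.1 q'.2.2 + D q')) -
          ∑' ij : ℤ × ℤ, lennardJones (dist (barlowPos a h s q.1 q.2.1 q.2.2 + D q)
              (barlowPos a h s (q.1 + k) ij.1 ij.2 +
                (((fun n : ℤ => if q₁ < n ∧ n < q₂ then shiftSign s q₁ n else 0) (q.1 + k) : ℤ) : ℝ) •
                  barlowOffset a))) -
         (∑ q' ∈ I.filter (fun q' => q'.1 = q.1 + k),
            lennardJones (dist (barlowPos a h s q.1 q.2.1 q.2.2) (barlowPos a h s q'.1 q'.2.1 q'.2.2)) -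
          ∑' ij : ℤ × ℤ, lennardJones (dist (barlowPos a h s q.1 q.2.1 q.2.2)
              (barlowPos a h s (q.1 + k) ij.1 ij.2))))|
      ≤ ∑ k ∈ Finset.Icc 1 K, |((∑ q' ∈ I.filter (fun q' => q'.1 = q.1 + k),
            lennardJones (dist (barlowPos a h s q.1 q.2.1 q.2.2 + D q)
              (barlowPos a h s q'.1 q'.2.1 q'.2.2 + D q')) -
          ∑' ij : ℤ × ℤ, lennardJones (dist (barlowPos a h s q.1 q.2.1 q.2.2 + D q)
              (barlowPos a h s (q.1 + k) ij.1 ij.2 +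
                (((fun n : ℤ => if q₁ < n ∧ n < q₂ then shiftSign s q₁ n else 0) (q.1 + k) : ℤ) : ℝ) •
                  barlowOffset a))) -
         (∑ q' ∈ I.filter (fun q' => q'.1 = q.1 + k),
            lennardJones (dist (barlowPos a h s q.1 q.2.1 q.2.2) (barlowPos a h s q'.1 q'.2.1 q'.2.2)) -
          ∑' ij : ℤ × ℤ, lennardJones (dist (barlowPos a h s q.1 q.2.1 q.2.2)
              (barlowPos a h s (q.1 + k) ij.1 ij.2))))| := Finset.abs_sum_le_sum_abs _ _
    _ ≤ _ := Finset.sum_le_sum hkey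
    _ ≤ 22000 * M⁻¹ ^ 3 + 11000 * M⁻¹ ^ 3 + 11000 * M⁻¹ ^ 3 := by
        rw [Finset.sum_add_distrib, Finset.sum_add_distrib]
        linarith [hJ1, htailN, htailO]
    _ = 44000 * M⁻¹ ^ 3 := by ring

/-- **The base disc holds `≥ ρ²/4` points** (`exists_box_lateral_sq_le`: an index box of layer `q₁`
about `(i₀, j₀)`, `(ρ/2a)² ≥ ρ²/4` for `a ≤ 1`; all of it is in the window). [folklore] -/
theorem ledger_base_count_ge : ∀ K : ℕ, 2 ≤ K →
    ∀ (a h : ℝ) (s : ℤ → ℤ) (q₁ q₂ i₀ j₀ : ℤ) (ρ R : ℝ) (I : Finset (ℤ × ℤ × ℤ))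
      (D : ℤ × ℤ × ℤ → (EuclideanSpace ℝ (Fin 3))) (Δ : ℤ × ℤ × ℤ → ℤ × ℤ × ℤ → ℝ),
      InBox a h → IsHaggSeq s → q₁ < q₂ → (3 : ℤ) ∣ haggLabel s q₂ - haggLabel s q₁ → 1 ≤ ρ →
      ρ + ((q₂ : ℝ) - q₁) * h + K * h + 1 ≤ R →
      (∀ q, InCyl a h s q₁ q₂ i₀ j₀ ρ q.1 q.2.1 q.2.2 →
        D q = ((shiftSign s q₁ q.1 : ℤ) : ℝ) • barlowOffset a) →
      (∀ q, ¬ InCyl a h s q₁ q₂ i₀ j₀ ρ q.1 q.2.1 q.2.2 → D q = 0) →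
      (∀ q q', Δ q q' =
        lennardJones (dist (barlowPos a h s q.1 q.2.1 q.2.2 + D q)
            (barlowPos a h s q'.1 q'.2.1 q'.2.2 + D q')) -
          lennardJones (dist (barlowPos a h s q.1 q.2.1 q.2.2)
            (barlowPos a h s q'.1 q'.2.1 q'.2.2))) →
      (∀ q, q ∈ I ↔ dist (barlowPos a h s q.1 q.2.1 q.2.2) (barlowPos a h s q₁ i₀ j₀) ≤ R) →
      ρ ^ 2 / 4 ≤ (((I.filter (fun q => q.1 = q₁ ∧ (latSq (barlowPos a h s q.1 q.2.1 q.2.2) (barlowPos a h s q₁ i₀ j₀) ≤ ρ ^ 2))).card : ℕ) : ℝ) := by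
  intro K hK a h s q₁ q₂ i₀ j₀ ρ R I D Δ hbox hs hq hcharge hρ hR hD₁ hD₀ hΔ hI
  classical
  obtain ⟨ha, hh⟩ := InBox.pos hbox
  have ha1 : a ≤ 1 := hbox.2.1
  have hρ0 : 0 ≤ ρ := by linarith
  obtain ⟨S, hS, hcard⟩ := exists_box_lateral_sq_le s ha q₁ i₀ j₀ hρ0
  have hmemI := mem_window_of_disc K hK a h s q₁ q₂ i₀ j₀ ρ R I D Δ hbox hs hq hcharge hρ hR hD₁ hD₀ hΔ hI
    q₁ (by rw [Finset.mem_Icc]; constructor <;> omega)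
  have hmaps : ∀ ij ∈ S, ((q₁, ij.1, ij.2) : ℤ × ℤ × ℤ) ∈
      I.filter (fun q => q.1 = q₁ ∧ (latSq (barlowPos a h s q.1 q.2.1 q.2.2) (barlowPos a h s q₁ i₀ j₀) ≤ ρ ^ 2)) := by
    intro ij hij
    rw [Finset.mem_filter]
    exact ⟨hmemI ij.1 ij.2 (hS ij hij), rfl, hS ij hij⟩
  have hinj : Set.InjOn (fun ij : ℤ × ℤ => ((q₁, ij.1, ij.2) : ℤ × ℤ × ℤ)) (S : Set (ℤ × ℤ)) := by
    intro ij _ ij' _ hh'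
    simp only [Prod.mk.injEq, true_and] at hh'
    exact Prod.ext hh'.1 hh'.2
  have h1 := Finset.card_le_card_of_injOn _ hmaps hinj
  have h2 : (S.card : ℝ) ≤ (((I.filter (fun q => q.1 = q₁ ∧ (latSq (barlowPos a h s q.1 q.2.1 q.2.2) (barlowPos a h s q₁ i₀ j₀) ≤ ρ ^ 2))).card : ℕ) : ℝ) := by
    exact_mod_cast h1
  refine le_trans ?_ (hcard.trans h2)
  rw [div_pow]
  have : (2 * a) ^ 2 ≤ 4 := by nlinarith
  rw [div_le_div_iff₀ (by norm_num) (by positivity)]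
  nlinarith [sq_nonneg ρ]

/-- **Disc counts of the layers differ by `≤ 143 ρ`** from the base-layer count
(`abs_card_sub_card_lateral_le`: two layers are lateral translates; `20 (2ρ/a + 5) ≤ 143 ρ` on the
box; the disc filters of the window are exactly the lateral discs by `mem_window_of_disc`).
[folklore] -/
theorem ledger_disc_count_sub_le : ∀ K : ℕ, 2 ≤ K →
    ∀ (a h : ℝ) (s : ℤ → ℤ) (q₁ q₂ i₀ j₀ : ℤ) (ρ R : ℝ) (I : Finset (ℤ × ℤ × ℤ))
      (D : ℤ × ℤ × ℤ → (EuclideanSpace ℝ (Fin 3))) (Δ : ℤ × ℤ × ℤ → ℤ × ℤ × ℤ → ℝ),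
      InBox a h → IsHaggSeq s → q₁ < q₂ → (3 : ℤ) ∣ haggLabel s q₂ - haggLabel s q₁ → 1 ≤ ρ →
      ρ + ((q₂ : ℝ) - q₁) * h + K * h + 1 ≤ R →
      (∀ q, InCyl a h s q₁ q₂ i₀ j₀ ρ q.1 q.2.1 q.2.2 →
        D q = ((shiftSign s q₁ q.1 : ℤ) : ℝ) • barlowOffset a) →
      (∀ q, ¬ InCyl a h s q₁ q₂ i₀ j₀ ρ q.1 q.2.1 q.2.2 → D q = 0) →
      (∀ q q', Δ q q' =
        lennardJones (dist (barlowPos a h s q.1 q.2.1 q.2.2 + D q)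
            (barlowPos a h s q'.1 q'.2.1 q'.2.2 + D q')) -
          lennardJones (dist (barlowPos a h s q.1 q.2.1 q.2.2)
            (barlowPos a h s q'.1 q'.2.1 q'.2.2))) →
      (∀ q, q ∈ I ↔ dist (barlowPos a h s q.1 q.2.1 q.2.2) (barlowPos a h s q₁ i₀ j₀) ≤ R) →
      ∀ m ∈ Finset.Icc (q₁ - K) q₂,
        |(((I.filter (fun q => q.1 = m ∧ (latSq (barlowPos a h s q.1 q.2.1 q.2.2) (barlowPos a h s q₁ i₀ j₀) ≤ ρ ^ 2))).card : ℕ) : ℝ) -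
          (((I.filter (fun q => q.1 = q₁ ∧ (latSq (barlowPos a h s q.1 q.2.1 q.2.2) (barlowPos a h s q₁ i₀ j₀) ≤ ρ ^ 2))).card : ℕ) : ℝ)| ≤ 143 * ρ := by
  intro K hK a h s q₁ q₂ i₀ j₀ ρ R I D Δ hbox hs hq hcharge hρ hR hD₁ hD₀ hΔ hI m hm
  classical
  obtain ⟨ha, hh⟩ := InBox.pos hbox
  have ha1 : 47 / 50 ≤ a := hbox.1
  have hρ0 : 0 ≤ ρ := by linarith
  have hmemI := mem_window_of_disc K hK a h s q₁ q₂ i₀ j₀ ρ R I D Δ hbox hs hq hcharge hρ hR hD₁ hD₀ hΔ hI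
  have hq₁ : q₁ ∈ Finset.Icc (q₁ - K) q₂ := by rw [Finset.mem_Icc]; constructor <;> omega
  -- the disc filters, projected to in-layer indices, are exactly the lateral discs
  have hproj : ∀ n ∈ Finset.Icc (q₁ - K) q₂,
      ((I.filter (fun q => q.1 = n ∧ (latSq (barlowPos a h s q.1 q.2.1 q.2.2) (barlowPos a h s q₁ i₀ j₀) ≤ ρ ^ 2))).image (fun q => q.2)).card =
        (I.filter (fun q => q.1 = n ∧ (latSq (barlowPos a h s q.1 q.2.1 q.2.2) (barlowPos a h s q₁ i₀ j₀) ≤ ρ ^ 2))).card ∧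
      ∀ ij : ℤ × ℤ, ij ∈ (I.filter (fun q => q.1 = n ∧ (latSq (barlowPos a h s q.1 q.2.1 q.2.2) (barlowPos a h s q₁ i₀ j₀) ≤ ρ ^ 2))).image (fun q => q.2) ↔
        (barlowPos a h s n ij.1 ij.2 0 - barlowPos a h s q₁ i₀ j₀ 0) ^ 2 +
          (barlowPos a h s n ij.1 ij.2 1 - barlowPos a h s q₁ i₀ j₀ 1) ^ 2 ≤ ρ ^ 2 := by
    intro n hn
    constructor
    · apply Finset.card_image_of_injOn
      intro q hq' q' hq'' hqq'
      rw [Finset.coe_filter, Set.mem_setOf_eq] at hq' hq''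
      exact Prod.ext (hq'.2.1.trans hq''.2.1.symm) hqq'
    · intro ij
      rw [Finset.mem_image]
      constructor
      · rintro ⟨q, hq', rfl⟩
        rw [Finset.mem_filter] at hq'
        obtain ⟨-, rfl, hd⟩ := hq'
        exact hd
      · intro hij
        refine ⟨(n, ij.1, ij.2), ?_, rfl⟩
        rw [Finset.mem_filter]
        exact ⟨hmemI n hn ij.1 ij.2 hij, rfl, hij⟩
  obtain ⟨hc1, hm1⟩ := hproj m hm
  obtain ⟨hc2, hm2⟩ := hproj q₁ hq₁
  have key := abs_card_sub_card_lateral_le s ha q₁ m (barlowPos a h s q₁ i₀ j₀) hρ0 _ _ hm2 hm1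
  rw [hc1, hc2] at key
  refine key.trans ?_
  have h1 : 2 * ρ / a ≤ 2 * ρ / (47 / 50) := div_le_div_of_nonneg_left (by positivity) (by norm_num) ha1
  have e : 2 * ρ / (47 / 50) = 100 / 47 * ρ := by ring
  nlinarith

/-- **The range-`K` chain change at a layer is bounded on the box**: `|ΔF_K(m)| ≤ J₀` with
`J₀ = 2 ∑_k u k`, `u` the summable majorant of `|J_{k+1}(a, h)|` on the quadrant `a ≥ 47/50`,
`h ≥ 7/10` (`exists_bound_barlowCoupling`; `|haggLocalEnergyTrunc| ≤ ∑_{k=2}^{K} |J_k|`). [folklore] -/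
theorem abs_localEnergyTrunc_flip_sub_le : ∃ J₀ : ℝ, 0 ≤ J₀ ∧
    ∀ (K : ℕ) (a h : ℝ) (s : ℤ → ℤ) (q₁ q₂ m : ℤ), InBox a h →
      |(haggLocalEnergyTrunc K (barlowCoupling lennardJones a h)
                  (fun n : ℤ => if q₁ ≤ n ∧ n < q₂ then -s n else s n) m -
                haggLocalEnergyTrunc K (barlowCoupling lennardJones a h) s m)| ≤ J₀ := by
  obtain ⟨u, hu, hb⟩ := LockedBoxMinimiser.exists_bound_barlowCoupling
    (a₁ := 47 / 50) (h₁ := 7 / 10) (by norm_num) (by norm_num)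
  have hu0 : ∀ k, 0 ≤ u k := fun k =>
    (abs_nonneg _).trans (hb k (47 / 50, 7 / 10) ⟨Set.self_mem_Ici, Set.self_mem_Ici⟩)
  refine ⟨2 * ∑' k, u k, mul_nonneg zero_le_two (tsum_nonneg hu0), ?_⟩
  intro K a h s q₁ q₂ m hbox
  obtain ⟨ha1, -, hh1, -⟩ := InBox.bounds hbox
  have hmem : (a, h) ∈ Set.Ici (47 / 50 : ℝ) ×ˢ Set.Ici (7 / 10 : ℝ) := ⟨ha1, hh1⟩
  have hJ : ∑ k ∈ Finset.Icc 2 K, |barlowCoupling lennardJones a h k| ≤ ∑' k, u k := by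
    have h1 : ∑ k ∈ Finset.Icc 2 K, |barlowCoupling lennardJones a h k| ≤
        ∑ k ∈ Finset.Icc 2 K, u (k - 1) := by
      refine Finset.sum_le_sum fun k hk => ?_
      rw [Finset.mem_Icc] at hk
      have := hb (k - 1) (a, h) hmem
      rwa [show k - 1 + 1 = k by omega] at this
    have h2 : ∑ k ∈ Finset.Icc 2 K, u (k - 1) = ∑ j ∈ (Finset.Icc 2 K).image (fun k => k - 1), u j := by
      rw [Finset.sum_image]
      intro k hk k' hk' hkk'
      rw [Finset.coe_Icc, Set.mem_Icc] at hk hk'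
      dsimp only at hkk'
      omega
    have h3 : ∑ j ∈ (Finset.Icc 2 K).image (fun k => k - 1), u j ≤ ∑' k, u k :=
      hu.sum_le_tsum _ (fun j _ => hu0 j)
    linarith
  have e1 := abs_haggLocalEnergyTrunc_le K (barlowCoupling lennardJones a h)
    (fun n : ℤ => if q₁ ≤ n ∧ n < q₂ then -s n else s n) m
  have e2 := abs_haggLocalEnergyTrunc_le K (barlowCoupling lennardJones a h) s m
  calc _ ≤ |haggLocalEnergyTrunc K (barlowCoupling lennardJones a h)
            (fun n : ℤ => if q₁ ≤ n ∧ n < q₂ then -s n else s n) m| +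
          |haggLocalEnergyTrunc K (barlowCoupling lennardJones a h) s m| := abs_sub _ _
    _ ≤ 2 * ∑' k, u k := by linarith

end Summit.AtomisticToContinuum.Crystallization.Theorems.SquareWellLayerCake.StackingFaultSparsity

end
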